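import Mathlib
import HarnessLib

/-!
# Convergence of formulas of Gauss type for singly and doubly infinite intervals

[cite: DavisRabinowitz1984, Sect. 3.7] P. J. Davis, P. Rabinowitz, *Methods of Numerical Integration*
(2nd ed., Academic Press, 1984), Sect. 3.7.

The Laguerre formulas of Gauss type
`L_n(f) = Σ_{k=1}^n w_{nk} f(x_{nk}) ≈ ∫_0^∞ e^{-x} x^α f(x) dx`, `α > -1` (3.7.1), exact for `f ∈ 𝒫_{2n-1}`,
and the Hermite formulas `H_n(f) = Σ w_{nk} f(x_{nk}) ≈ ∫_{-∞}^{∞} e^{-x²} f(x) dx` (3.7.4).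

* `laguerreWeightIntegral α f = ∫_0^∞ e^{-x} x^α f(x) dx`, `hermiteWeightIntegral f = ∫ e^{-x²} f(x) dx`,
  `nodeWeightSum x w f = Σ_k w_k f(x_k)`;
* `IsLaguerreGaussRule α n x w` (3.7.1): an `n`-point rule with nodes in `(0, ∞)`, exact on `𝒫_{2n-1}` for the
  weight `e^{-x} x^α`; `IsHermiteGaussRule n x w` (3.7.4) likewise for `e^{-x²}`;
* the growth conditions `LaguerreGrowth α ρ f` (3.7.2): `|f(x)| ≤ eˣ / x^{α+1+ρ}` for all sufficiently large `x`,
  and `HermiteGrowth ρ f` (3.7.5): `|f(x)| ≤ e^{x²} / |x|^{1+ρ}` for all sufficiently large `|x|`;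
* USPENSKY'S CONVERGENCE THEOREMS (3.7.2) ⟹ (3.7.3) and (3.7.5) ⟹ (3.7.6), recorded as NAMED FACTS
  (`UspenskyLaguerre`, `UspenskyHermite`): the text refers to Uspensky for the proofs;
* LUBINSKY'S GEOMETRIC CONVERGENCE for entire `f = Σ bₙ zⁿ` (3.7.7)–(3.7.10), recorded as NAMED FACTS
  (`LubinskyLaguerre`, `LubinskyHermite`) in a form implied by the printed statement (any `A' ∈ (A, 1)`).

Proved here (Mathlib only): the weight moments `∫_0^∞ e^{-x} x^α dx = Γ(α+1)` and
`∫_0^∞ e^{-x} x^α · x dx = (α+1) Γ(α+1)`; the one-point rule with node `α + 1` and weight `Γ(α + 1)` is the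
Laguerre formula of Gauss type for `n = 1` (`isLaguerreGaussRule_one`); every polynomial satisfies the growth
condition (3.7.2) (`laguerreGrowth_polynomial`), so Uspensky's hypothesis covers the exactness class; and under
(3.7.2) the weighted integrand `e^{-x} x^α f(x)` is absolutely integrable on a tail `(X, ∞)`
(`integrableOn_tail_of_laguerreGrowth`), i.e. the right-hand side of (3.7.3) is a convergent integral at `∞`.
-/

noncomputable section

open Real MeasureTheory Filter Topology Polynomial Finset Set

namespace Literature.Analysis.Quadrature

/-! ### The functionals and the rules -/

/-- `I_α(f) = ∫_0^∞ e^{-x} x^α f(x) dx`, the Laguerre-weight integral of (3.7.1).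
[cite: DavisRabinowitz1984, Sect. 3.7 (3.7.1)] -/
def laguerreWeightIntegral (α : ℝ) (f : ℝ → ℝ) : ℝ :=
  ∫ x in Ioi (0 : ℝ), exp (-x) * x ^ α * f x

/-- `∫_{-∞}^{∞} e^{-x²} f(x) dx`, the Hermite-weight integral of (3.7.4).
[cite: DavisRabinowitz1984, Sect. 3.7 (3.7.4)] -/
def hermiteWeightIntegral (f : ℝ → ℝ) : ℝ :=
  ∫ x : ℝ, exp (-x ^ 2) * f x

/-- The value `Σ_{k=1}^n w_k f(x_k)` of an `n`-point rule with nodes `x` and weights `w`.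
[cite: DavisRabinowitz1984, Sect. 3.7 (3.7.1)] -/
def nodeWeightSum {n : ℕ} (x w : Fin n → ℝ) (f : ℝ → ℝ) : ℝ :=
  ∑ k, w k * f (x k)

/-- (3.7.1): `(x, w)` is an `n`-point Laguerre formula of Gauss type for the weight `e^{-x} x^α` on `(0, ∞)`:
its nodes lie in `(0, ∞)` and it is exact for every polynomial of degree `≤ 2n - 1`.
[cite: DavisRabinowitz1984, Sect. 3.7 (3.7.1)] -/
def IsLaguerreGaussRule (α : ℝ) (n : ℕ) (x w : Fin n → ℝ) : Prop :=
  (∀ k, 0 < x k) ∧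
    ∀ p : ℝ[X], p.natDegree ≤ 2 * n - 1 →
      nodeWeightSum x w (fun t => p.eval t) = laguerreWeightIntegral α fun t => p.eval t

/-- (3.7.4): `(x, w)` is an `n`-point Hermite formula of Gauss type for the weight `e^{-x²}` on `ℝ`:
it is exact for every polynomial of degree `≤ 2n - 1`.
[cite: DavisRabinowitz1984, Sect. 3.7 (3.7.4)] -/
def IsHermiteGaussRule (n : ℕ) (x w : Fin n → ℝ) : Prop :=
  ∀ p : ℝ[X], p.natDegree ≤ 2 * n - 1 →
    nodeWeightSum x w (fun t => p.eval t) = hermiteWeightIntegral fun t => p.eval t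

/-- The growth condition (3.7.2): `|f(x)| ≤ eˣ / x^{α+1+ρ}` for all sufficiently large `x`.
[cite: DavisRabinowitz1984, Sect. 3.7 (3.7.2)] -/
def LaguerreGrowth (α ρ : ℝ) (f : ℝ → ℝ) : Prop :=
  ∃ X : ℝ, ∀ x : ℝ, X ≤ x → |f x| ≤ exp x / x ^ (α + 1 + ρ)

/-- The growth condition (3.7.5): `|f(x)| ≤ e^{x²} / |x|^{1+ρ}` for all sufficiently large `|x|`.
[cite: DavisRabinowitz1984, Sect. 3.7 (3.7.5)] -/
def HermiteGrowth (ρ : ℝ) (f : ℝ → ℝ) : Prop :=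
  ∃ X : ℝ, ∀ x : ℝ, X ≤ |x| → |f x| ≤ exp (x ^ 2) / |x| ^ (1 + ρ)

/-! ### Uspensky's convergence theorems (named facts) -/

/-- NAMED FACT — Uspensky's theorem for the Laguerre formulas, (3.7.2) ⟹ (3.7.3): for `α > -1` and `f`
continuous on `[0, ∞)` with `|f(x)| ≤ eˣ/x^{α+1+ρ}` for some `ρ > 0` and all large `x`, every sequence of
Laguerre formulas of Gauss type converges: `L_n(f) → ∫_0^∞ e^{-x} x^α f(x) dx`.  (Stated for continuous `f`;
the text gives no proof and refers to Uspensky.)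
[cite: DavisRabinowitz1984, Sect. 3.7 (3.7.2)-(3.7.3)] -/
def UspenskyLaguerre : Prop :=
  ∀ α : ℝ, -1 < α → ∀ f : ℝ → ℝ, ContinuousOn f (Ici 0) → (∃ ρ : ℝ, 0 < ρ ∧ LaguerreGrowth α ρ f) →
    ∀ (x w : (n : ℕ) → Fin n → ℝ), (∀ n, 1 ≤ n → IsLaguerreGaussRule α n (x n) (w n)) →
      Tendsto (fun n => nodeWeightSum (x n) (w n) f) atTop (𝓝 (laguerreWeightIntegral α f))

/-- NAMED FACT — Uspensky's theorem for the Hermite formulas, (3.7.5) ⟹ (3.7.6): for `f` continuous on `ℝ`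
with `|f(x)| ≤ e^{x²}/|x|^{1+ρ}` for some `ρ > 0` and all large `|x|`, every sequence of Hermite formulas of
Gauss type converges: `H_n(f) → ∫ e^{-x²} f(x) dx`.
[cite: DavisRabinowitz1984, Sect. 3.7 (3.7.5)-(3.7.6)] -/
def UspenskyHermite : Prop :=
  ∀ f : ℝ → ℝ, Continuous f → (∃ ρ : ℝ, 0 < ρ ∧ HermiteGrowth ρ f) →
    ∀ (x w : (n : ℕ) → Fin n → ℝ), (∀ n, 1 ≤ n → IsHermiteGaussRule n (x n) (w n)) →
      Tendsto (fun n => nodeWeightSum (x n) (w n) f) atTop (𝓝 (hermiteWeightIntegral f))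

/-! ### Lubinsky's geometric convergence for entire functions (named facts) -/

/-- NAMED FACT — Lubinsky, (3.7.7) and (3.7.9): let `f(x) = Σ bₙ xⁿ` be entire and
`A = limsup (|bₙ|^{1/n} · n/2)`; if `A < 1` then `|∫_0^∞ e^{-x} x^α f dx - L_n(f)| ≤ A^{2n}` for all
sufficiently large `n`.  Recorded in the (weaker, implied) form: if `|bₙ|^{1/n} n/2 ≤ A` for all large `n`, then
for every `A'` with `A < A' < 1` the error is eventually `≤ A'^{2n}`.
[cite: DavisRabinowitz1984, Sect. 3.7 (3.7.7), (3.7.9)] -/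
def LubinskyLaguerre : Prop :=
  ∀ α : ℝ, -1 < α → ∀ (b : ℕ → ℝ) (f : ℝ → ℝ), (∀ x : ℝ, HasSum (fun n => b n * x ^ n) (f x)) →
    ∀ A : ℝ, (∀ᶠ n : ℕ in atTop, |b n| ^ (1 / (n : ℝ)) * ((n : ℝ) / 2) ≤ A) →
      ∀ A' : ℝ, A < A' → A' < 1 →
        ∀ (x w : (n : ℕ) → Fin n → ℝ), (∀ n, 1 ≤ n → IsLaguerreGaussRule α n (x n) (w n)) →
          ∀ᶠ n : ℕ in atTop, |laguerreWeightIntegral α f - nodeWeightSum (x n) (w n) f| ≤ A' ^ (2 * n)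

/-- NAMED FACT — Lubinsky, (3.7.8) and (3.7.10): with `B = limsup (|bₙ|^{1/n} · √(n/2))`, if `B < 1` then
`|∫ e^{-x²} f dx - H_n(f)| ≤ B^{2n}` for all sufficiently large `n`; recorded in the implied form with any
`B' ∈ (B, 1)`.
[cite: DavisRabinowitz1984, Sect. 3.7 (3.7.8), (3.7.10)] -/
def LubinskyHermite : Prop :=
  ∀ (b : ℕ → ℝ) (f : ℝ → ℝ), (∀ x : ℝ, HasSum (fun n => b n * x ^ n) (f x)) →
    ∀ B : ℝ, (∀ᶠ n : ℕ in atTop, |b n| ^ (1 / (n : ℝ)) * Real.sqrt ((n : ℝ) / 2) ≤ B) →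
      ∀ B' : ℝ, B < B' → B' < 1 →
        ∀ (x w : (n : ℕ) → Fin n → ℝ), (∀ n, 1 ≤ n → IsHermiteGaussRule n (x n) (w n)) →
          ∀ᶠ n : ℕ in atTop, |hermiteWeightIntegral f - nodeWeightSum (x n) (w n) f| ≤ B' ^ (2 * n)

/-! ### The weight moments and the one-point Laguerre formula -/

/-- [folklore] `x ↦ e^{-x} x^β` is integrable on `(0, ∞)` for `β > -1` (Euler's integral; local helper). -/
private theorem integrableOn_laguerreWeight {β : ℝ} (hβ : -1 < β) :
    IntegrableOn (fun x : ℝ => exp (-x) * x ^ β) (Ioi 0) := by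
  have h := Real.GammaIntegral_convergent (by linarith : (0 : ℝ) < β + 1)
  simpa only [add_sub_cancel_right] using h

/-- The zeroth moment of the Laguerre weight: `∫_0^∞ e^{-x} x^α dx = Γ(α + 1)` (`α > -1`).
[cite: DavisRabinowitz1984, Sect. 3.7 (3.7.1)] -/
theorem integral_laguerreWeight {α : ℝ} (hα : -1 < α) :
    ∫ x in Ioi (0 : ℝ), exp (-x) * x ^ α = Gamma (α + 1) := by
  have h := Real.Gamma_eq_integral (by linarith : (0 : ℝ) < α + 1)
  simp only [add_sub_cancel_right] at h
  exact h.symm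

/-- The first moment: `∫_0^∞ e^{-x} x^α · x dx = (α + 1) Γ(α + 1)` (`α > -1`).
[cite: DavisRabinowitz1984, Sect. 3.7 (3.7.1)] -/
theorem integral_laguerreWeight_mul_self {α : ℝ} (hα : -1 < α) :
    ∫ x in Ioi (0 : ℝ), exp (-x) * x ^ α * x = (α + 1) * Gamma (α + 1) := by
  have h1 : ∫ x in Ioi (0 : ℝ), exp (-x) * x ^ α * x = ∫ x in Ioi (0 : ℝ), exp (-x) * x ^ (α + 1) := by
    refine setIntegral_congr_fun measurableSet_Ioi fun x hx => ?_
    simp only [Set.mem_Ioi] at hx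
    rw [Real.rpow_add_one hx.ne', mul_assoc]
  rw [h1, integral_laguerreWeight (by linarith : (-1 : ℝ) < α + 1),
    Real.Gamma_add_one (by linarith : (α + 1 : ℝ) ≠ 0)]

/-- `I_α` of an affine function: `∫_0^∞ e^{-x} x^α (a + b x) dx = Γ(α+1) (a + b (α+1))`.
[cite: DavisRabinowitz1984, Sect. 3.7 (3.7.1)] -/
theorem laguerreWeightIntegral_affine {α : ℝ} (hα : -1 < α) (a b : ℝ) :
    laguerreWeightIntegral α (fun t => a + b * t) = Gamma (α + 1) * (a + b * (α + 1)) := by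
  unfold laguerreWeightIntegral
  have hi0 := integrableOn_laguerreWeight hα
  have hi1 : IntegrableOn (fun x : ℝ => exp (-x) * x ^ α * x) (Ioi 0) := by
    have h := integrableOn_laguerreWeight (by linarith : (-1 : ℝ) < α + 1)
    refine h.congr_fun (fun x hx => ?_) measurableSet_Ioi
    simp only [Set.mem_Ioi] at hx
    show exp (-x) * x ^ (α + 1) = exp (-x) * x ^ α * x
    rw [Real.rpow_add_one hx.ne', mul_assoc]
  have hsplit : (fun x : ℝ => exp (-x) * x ^ α * (a + b * x)) =
      fun x => a * (exp (-x) * x ^ α) + b * (exp (-x) * x ^ α * x) := by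
    funext x; ring
  rw [hsplit, integral_add (hi0.const_mul a) (hi1.const_mul b), integral_const_mul, integral_const_mul,
    integral_laguerreWeight hα, integral_laguerreWeight_mul_self hα]
  ring

/-- The one-point Laguerre formula of Gauss type: node `x₁ = α + 1`, weight `w₁ = Γ(α + 1)`; it is exact on
`𝒫₁`, i.e. it is the rule (3.7.1) with `n = 1`.
[cite: DavisRabinowitz1984, Sect. 3.7 (3.7.1)] -/
theorem isLaguerreGaussRule_one {α : ℝ} (hα : -1 < α) :
    IsLaguerreGaussRule α 1 (fun _ => α + 1) (fun _ => Gamma (α + 1)) := by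
  refine ⟨fun _ => by linarith, fun p hp => ?_⟩
  have hp' : p.natDegree ≤ 1 := by simpa using hp
  have hform : ∀ t : ℝ, p.eval t = p.coeff 0 + p.coeff 1 * t := by
    intro t
    rw [eq_X_add_C_of_natDegree_le_one hp']
    simp; ring
  simp only [nodeWeightSum, Fin.sum_univ_one, hform]
  rw [laguerreWeightIntegral_affine hα]

/-! ### Polynomials satisfy the growth condition (3.7.2) -/

/-- [folklore] A polynomial is dominated by `(Σ |cᵢ|) · x^{deg p}` for `x ≥ 1` (local helper). -/
private theorem abs_eval_le_coeffAbsSum_mul_pow (p : ℝ[X]) {x : ℝ} (hx : 1 ≤ x) :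
    |p.eval x| ≤ (∑ i ∈ range (p.natDegree + 1), |p.coeff i|) * x ^ p.natDegree := by
  rw [eval_eq_sum_range, sum_mul]
  refine (abs_sum_le_sum_abs _ _).trans (sum_le_sum fun i hi => ?_)
  rw [abs_mul, abs_of_nonneg (pow_nonneg (zero_le_one.trans hx) i)]
  refine mul_le_mul_of_nonneg_left ?_ (abs_nonneg _)
  exact pow_le_pow_right₀ hx (Nat.lt_succ_iff.mp (mem_range.mp hi))

/-- Every polynomial satisfies Uspensky's growth condition (3.7.2), for every `α` and `ρ`:
`|p(x)| ≤ eˣ / x^{α+1+ρ}` for all sufficiently large `x` (since `x^m e^{-x} → 0`).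
[cite: DavisRabinowitz1984, Sect. 3.7 (3.7.2)] -/
theorem laguerreGrowth_polynomial (α ρ : ℝ) (p : ℝ[X]) : LaguerreGrowth α ρ fun t => p.eval t := by
  set C : ℝ := ∑ i ∈ range (p.natDegree + 1), |p.coeff i| with hC
  have hC0 : 0 ≤ C := sum_nonneg fun i _ => abs_nonneg _
  set m : ℝ := (p.natDegree : ℝ) + (α + 1 + ρ) with hm
  -- `x^m e^{-x} → 0`, hence eventually `≤ 1 / (C + 1)`.
  have ht : Tendsto (fun x : ℝ => x ^ m * exp (-1 * x)) atTop (𝓝 0) :=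
    tendsto_rpow_mul_exp_neg_mul_atTop_nhds_zero m 1 one_pos
  have hev : ∀ᶠ x : ℝ in atTop, x ^ m * exp (-1 * x) ≤ 1 / (C + 1) :=
    (ht.eventually (ge_mem_nhds (by positivity : (0 : ℝ) < 1 / (C + 1)))).mono fun x hx => hx
  obtain ⟨X, hX⟩ := (hev.and (eventually_ge_atTop 1)).exists_forall_of_atTop
  refine ⟨X, fun x hx => ?_⟩
  obtain ⟨h1, hx1⟩ := hX x hx
  have hx0 : 0 < x := by linarith
  have hpos : 0 < x ^ (α + 1 + ρ) := Real.rpow_pos_of_pos hx0 _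
  rw [le_div_iff₀ hpos]
  -- `|p x| · x^{α+1+ρ} ≤ C x^{deg p} x^{α+1+ρ} = C x^m ≤ C/(C+1) · eˣ ≤ eˣ`.
  have hbound := abs_eval_le_coeffAbsSum_mul_pow p hx1
  have hxm : x ^ m = x ^ p.natDegree * x ^ (α + 1 + ρ) := by
    rw [hm, Real.rpow_add hx0, Real.rpow_natCast]
  have h2 : x ^ m ≤ 1 / (C + 1) * exp x := by
    have := h1
    rw [show (-1 : ℝ) * x = -x by ring] at this
    calc x ^ m = x ^ m * exp (-x) * exp x := by rw [mul_assoc, ← Real.exp_add]; simp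
      _ ≤ 1 / (C + 1) * exp x := by
          exact mul_le_mul_of_nonneg_right this (exp_pos x).le
  calc |p.eval x| * x ^ (α + 1 + ρ) ≤ C * x ^ p.natDegree * x ^ (α + 1 + ρ) :=
        mul_le_mul_of_nonneg_right hbound hpos.le
    _ = C * x ^ m := by rw [hxm, mul_assoc]
    _ ≤ C * (1 / (C + 1) * exp x) := mul_le_mul_of_nonneg_left h2 hC0
    _ ≤ exp x := by
        rw [← mul_assoc]
        have : C * (1 / (C + 1)) ≤ 1 := by
          rw [mul_one_div, div_le_one (by linarith)]; linarith
        exact (mul_le_mul_of_nonneg_right this (exp_pos x).le).trans (by rw [one_mul])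

/-! ### Under (3.7.2) the integral (3.7.3) converges absolutely at `∞` -/

/-- If `|f(x)| ≤ eˣ/x^{α+1+ρ}` for `x ≥ X > 0` with `ρ > 0` and `f` is continuous on `[0, ∞)`, then
`e^{-x} x^α f(x)` is integrable on `(X, ∞)`: it is dominated there by `x^{-(1+ρ)}`.
[cite: DavisRabinowitz1984, Sect. 3.7 (3.7.2)-(3.7.3)] -/
theorem integrableOn_tail_of_laguerreGrowth {α ρ X : ℝ} {f : ℝ → ℝ} (hρ : 0 < ρ) (hX : 0 < X)
    (hf : ContinuousOn f (Ici 0)) (hg : ∀ x : ℝ, X ≤ x → |f x| ≤ exp x / x ^ (α + 1 + ρ)) :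
    IntegrableOn (fun x : ℝ => exp (-x) * x ^ α * f x) (Ioi X) := by
  have hdom : IntegrableOn (fun x : ℝ => x ^ (-(1 + ρ))) (Ioi X) :=
    integrableOn_Ioi_rpow_of_lt (by linarith) hX
  have hmeas : AEStronglyMeasurable (fun x : ℝ => exp (-x) * x ^ α * f x) (volume.restrict (Ioi X)) := by
    have hc : ContinuousOn (fun x : ℝ => exp (-x) * x ^ α * f x) (Ioi X) := by
      refine ((continuous_exp.comp continuous_neg).continuousOn.mul ?_).mul (hf.mono fun x hx => ?_)
      · exact continuousOn_id.rpow_const fun x hx => Or.inl (ne_of_gt (hX.trans hx))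
      · exact le_of_lt (hX.trans hx)
    exact hc.aestronglyMeasurable measurableSet_Ioi
  refine Integrable.mono' hdom hmeas ?_
  refine (ae_restrict_iff' measurableSet_Ioi).mpr (ae_of_all _ fun x hx => ?_)
  simp only [Set.mem_Ioi] at hx
  have hx0 : 0 < x := hX.trans hx
  have hxa : 0 < x ^ α := Real.rpow_pos_of_pos hx0 _
  rw [norm_mul, norm_mul, Real.norm_eq_abs, Real.norm_eq_abs, Real.norm_eq_abs, abs_of_pos (exp_pos _),
    abs_of_pos hxa]
  calc exp (-x) * x ^ α * |f x| ≤ exp (-x) * x ^ α * (exp x / x ^ (α + 1 + ρ)) :=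
        mul_le_mul_of_nonneg_left (hg x hx.le) (by positivity)
    _ = x ^ (-(1 + ρ)) := by
        rw [Real.rpow_neg hx0.le, Real.rpow_add hx0, Real.rpow_add hx0, Real.rpow_one]
        field_simp
        rw [← Real.exp_add, neg_add_cancel, Real.exp_zero, one_mul, Real.rpow_add hx0, Real.rpow_one]

end Literature.Analysis.Quadrature

end
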